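import Literature.NumberTheory.Automorphic.RatIdeleCongruence
import Literature.NumberTheory.Automorphic.WhittakerBesselGL2
import HarnessLib

/-!
# The Gauss-sum torus average of a `K₁(M²)`-eigenvector on `GL₂(𝔸_ℚ)` (towards the existence of
# the new vector, Casselman 1973, Thm. 1)

Topic `NumberTheory/Automorphic`; namespace `Literature.NumberTheory.Automorphic`. Algebraic half of
an elementary global proof of the **existence of the new vector** for automorphic representations of
`GL₂(𝔸_ℚ)` (Casselman 1973, Thm. 1, existence half; Gelbart 1975, Thm. 5.19 input): every
automorphic `π` with cuspidal forms has a non-zero form right invariant under `{1} × K₁(L)` for some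
`L` (`GL2NewvectorExistence`). The tree's `GL2NewvectorUpToTwist` produces from a `K(M)`-fixed form a
non-zero `v ∈ π` which is an **eigenvector of `{1} × K₁(M²)` for the character `χ([det k] mod M)`**
(`χ` a Dirichlet character mod `M`; `AutomorphicRepData.exists_detChar_eigenvector` below). This file
removes the character `χ ∘ [det]` by a Gauss-sum average, at the cost of raising the level:

* `gaussTorusAverage M d v = B_d v := ∑_{a ∈ (ℤ/dM)ˣ} r((1, d(s_a) n(d⁻¹))) v`, where
  `n(d⁻¹) = (1 d⁻¹; 0 1) ∈ GL₂(𝔸_ℚ^∞)` (`d⁻¹ ∈ ℚ ⊆ 𝔸_ℚ^∞`), `d(s) = diag(s, 1)` and `s_a ∈ ẑˣ` represents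
  `a` (`ẑˣ/(1 + dM ẑ) = (ℤ/dM)ˣ`, `RatIdeleCongruence`); it is the isotypic component for the TRIVIAL
  character of `x₀ = r(n(d⁻¹)) v` under the torus `d(ẑˣ)` (`charComponent` of `GL2NewvectorUpToTwist`),
  well defined because `d(s) x₀ = x₀` for `s ≡ 1 (dM)` (`finTorusRep_unipotentTranslate_eq`);
* `gaussTorusAverage_mem` — `B_d v ∈ π` when `v ∈ π`;
* **invariance** (`gaussTorusAverage_mem_gammaOneFiniteInvariants`): `B_d v` is right invariant under
  `{1} × K₁((dM)²)`: under `d(ẑˣ)` by construction, under `{k ∈ K₁((dM)²) | det k = 1}` because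
  `n(-d⁻¹) k n(d⁻¹) ∈ K₁(M²)` has determinant `1` (`conj_unipotentGL2_mem_gammaOneFiniteLevel`), and
  `K₁ = d(ẑˣ) · K₁^{det = 1}`;
* `gaussTorusAverage_apply` — the pointwise formula `B_d v (x) = ∑_a v(x (1, d(s_a) n(d⁻¹)))`, from which
  `GL2NewvectorExistence` computes the Whittaker coefficients of `B_d v` (a Gauss sum of the primitive
  character of `χ` times those of `v`) and proves `B_d v ≠ 0` for a suitable `d`.

Everything is proved; the definitions are `diagOneHom`, `Rat.finTorusRep`, `Rat.finTorusRed`,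
`gaussTorusAverage`.

## References

* W. Casselman, *On some results of Atkin and Lehner*, Math. Ann. 201 (1973), Thm. 1 [Casselman1973].
* S. Gelbart, *Automorphic forms on adele groups* (1975), §5.B and Thm. 5.19 [Gelbart1975].
-/

noncomputable section

open NumberField IsDedekindDomain Matrix
open scoped MatrixGroups Classical

namespace Literature.NumberTheory.Automorphic

open IsDedekindDomain.HeightOneSpectrum Rat.HeightOneSpectrum GaloisRepresentations

/-! ### Level arithmetic in `𝔸_ℚ^∞` -/

section LevelArith

/-- `d⁻¹ c ∈ e ẑ` for `c ∈ d e ẑ`. [folklore] -/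
theorem Rat.natUnitFinite_inv_mul_mem_levelIdeal_of_mul {d e : ℕ} [NeZero d] [NeZero e] {c : FiniteAdeleRing (𝓞 ℚ) ℚ}
    (hc : c ∈ levelIdeal ℚ (Ideal.span {((d * e : ℕ) : 𝓞 ℚ)})) :
    (((Rat.natUnitFinite d)⁻¹ : (FiniteAdeleRing (𝓞 ℚ) ℚ)ˣ) : FiniteAdeleRing (𝓞 ℚ) ℚ) * c ∈
      levelIdeal ℚ (Ideal.span {(e : 𝓞 ℚ)}) := by
  rw [mem_levelIdeal_iff] at hc ⊢
  intro v
  rw [FiniteAdeleRing.mul_apply', map_mul, Rat.valued_natUnitFinite_inv]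
  have h0 := Rat.idealRadius_span_natCast_ne_zero (M := d) v
  have hde : idealRadius ℚ v (Ideal.span {((d * e : ℕ) : 𝓞 ℚ)}) =
      idealRadius ℚ v (Ideal.span {(d : 𝓞 ℚ)}) * idealRadius ℚ v (Ideal.span {(e : 𝓞 ℚ)}) := by
    rw [Rat.idealRadius_span_natCast v (mul_ne_zero (NeZero.ne d) (NeZero.ne e)),
      Rat.idealRadius_span_natCast v (NeZero.ne d), Rat.idealRadius_span_natCast v (NeZero.ne e),
      Nat.cast_mul, map_mul]
  calc (idealRadius ℚ v (Ideal.span {(d : 𝓞 ℚ)}))⁻¹ * Valued.v (c v)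
      ≤ (idealRadius ℚ v (Ideal.span {(d : 𝓞 ℚ)}))⁻¹ * idealRadius ℚ v (Ideal.span {((d * e : ℕ) : 𝓞 ℚ)}) :=
        mul_le_mul' le_rfl (hc v)
    _ = idealRadius ℚ v (Ideal.span {(e : 𝓞 ℚ)}) := by rw [hde, ← mul_assoc, inv_mul_cancel₀ h0, one_mul]

/-- `d⁻¹ c ∈ ẑ` for `c ∈ d ẑ`. [folklore] -/
theorem Rat.natUnitFinite_inv_mul_integral {d : ℕ} [NeZero d] {c : FiniteAdeleRing (𝓞 ℚ) ℚ}
    (hc : c ∈ levelIdeal ℚ (Ideal.span {(d : 𝓞 ℚ)})) (w : HeightOneSpectrum (𝓞 ℚ)) :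
    ((((Rat.natUnitFinite d)⁻¹ : (FiniteAdeleRing (𝓞 ℚ) ℚ)ˣ) : FiniteAdeleRing (𝓞 ℚ) ℚ) * c) w ∈
      w.adicCompletionIntegers ℚ := by
  have hc' : c ∈ levelIdeal ℚ (Ideal.span {((d * 1 : ℕ) : 𝓞 ℚ)}) := by rwa [mul_one]
  exact mem_integralFiniteAdeles_of_mem_levelIdeal (Rat.natUnitFinite_inv_mul_mem_levelIdeal_of_mul hc') w

/-- `N ẑ ⊆ ẑ` componentwise. [folklore] -/
theorem Rat.integral_of_mem_levelIdeal {𝔫 : Ideal (𝓞 ℚ)} {c : FiniteAdeleRing (𝓞 ℚ) ℚ} (hc : c ∈ levelIdeal ℚ 𝔫)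
    (w : HeightOneSpectrum (𝓞 ℚ)) : c w ∈ w.adicCompletionIntegers ℚ :=
  mem_integralFiniteAdeles_of_mem_levelIdeal hc w

end LevelArith

/-! ### Torus and unipotent elements of `K₁(𝔫)`; determinants -/

section Elements

/-- The **mirabolic torus** `y ↦ d(y) = diag(y, 1)` as a homomorphism `Rˣ → GL₂(R)`. [folklore] -/
def diagOneHom (R : Type*) [CommRing R] : Rˣ →* GL (Fin 2) R where
  toFun y := diagGL2 y 1
  map_one' := diagGL2_one
  map_mul' a b := by rw [← diagGL2_mul, mul_one]

/-- Unfolding `diagOneHom`. [folklore] -/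
@[simp] theorem diagOneHom_apply {R : Type*} [CommRing R] (y : Rˣ) : diagOneHom R y = diagGL2 y 1 := rfl

/-- `d(y)⁻¹ = d(y⁻¹)`. [folklore] -/
theorem diagGL2_one_inv {R : Type*} [CommRing R] (y : Rˣ) : (diagGL2 y 1)⁻¹ = diagGL2 y⁻¹ 1 := by
  rw [← diagOneHom_apply, ← map_inv, diagOneHom_apply]

/-- `det d(y) = y`. [folklore] -/
theorem det_diagGL2_one {R : Type*} [CommRing R] (y : Rˣ) : Matrix.GeneralLinearGroup.det (diagGL2 y 1) = y := by
  refine Units.ext ?_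
  rw [Matrix.GeneralLinearGroup.val_det_apply, coe_diagGL2, Matrix.det_fin_two_of, Units.val_one]
  ring

/-- `n(-x) = n(x)⁻¹`. [folklore] -/
theorem unipotentGL2_neg_eq_inv {R : Type*} [CommRing R] (x : R) : unipotentGL2 (-x) = (unipotentGL2 x)⁻¹ :=
  eq_inv_of_mul_eq_one_right (by rw [← unipotentGL2_add, add_neg_cancel, unipotentGL2_zero])

/-- `det n(x) = 1`. [folklore] -/
theorem det_coe_unipotentGL2 {R : Type*} [CommRing R] (x : R) :
    Matrix.GeneralLinearGroup.det ((unipotentGL2 x : ↥(upperUnitriangular (Fin 2) R)) : GL (Fin 2) R) = 1 := by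
  refine Units.ext ?_
  rw [Matrix.GeneralLinearGroup.val_det_apply, coe_unipotentGL2, Matrix.det_fin_two_of, Units.val_one]
  ring

/-- The entries of `d(y)`: `y, 0, 0, 1`. [folklore] -/
theorem diagGL2_one_entries {R : Type*} [CommRing R] (y : Rˣ) :
    ((diagGL2 y 1 : GL (Fin 2) R) : Matrix (Fin 2) (Fin 2) R) 0 0 = y ∧
      ((diagGL2 y 1 : GL (Fin 2) R) : Matrix (Fin 2) (Fin 2) R) 0 1 = 0 ∧
      ((diagGL2 y 1 : GL (Fin 2) R) : Matrix (Fin 2) (Fin 2) R) 1 0 = 0 ∧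
      ((diagGL2 y 1 : GL (Fin 2) R) : Matrix (Fin 2) (Fin 2) R) 1 1 = 1 := by
  simp [coe_diagGL2]

/-- The entries of `n(x)`: `1, x, 0, 1`. [folklore] -/
theorem unipotentGL2_entries {R : Type*} [CommRing R] (x : R) :
    (((unipotentGL2 x : ↥(upperUnitriangular (Fin 2) R)) : GL (Fin 2) R) : Matrix (Fin 2) (Fin 2) R) 0 0 = 1 ∧
      (((unipotentGL2 x : ↥(upperUnitriangular (Fin 2) R)) : GL (Fin 2) R) : Matrix (Fin 2) (Fin 2) R) 0 1 = x ∧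
      (((unipotentGL2 x : ↥(upperUnitriangular (Fin 2) R)) : GL (Fin 2) R) : Matrix (Fin 2) (Fin 2) R) 1 0 = 0 ∧
      (((unipotentGL2 x : ↥(upperUnitriangular (Fin 2) R)) : GL (Fin 2) R) : Matrix (Fin 2) (Fin 2) R) 1 1 = 1 := by
  simp [coe_unipotentGL2]

variable {𝔫 : Ideal (𝓞 ℚ)}

/-- **`d(y) ∈ K₁(𝔫)` for `y ∈ ẑˣ`** (every level `𝔫`). [folklore] -/
theorem Rat.diagGL2_mem_gammaOneFiniteLevel {y : (FiniteAdeleRing (𝓞 ℚ) ℚ)ˣ} (hy : y ∈ Rat.finiteIntegralUnits)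
    (𝔫 : Ideal (𝓞 ℚ)) : diagGL2 y 1 ∈ gammaOneFiniteLevel ℚ 𝔫 := by
  have hent : ∀ z : (FiniteAdeleRing (𝓞 ℚ) ℚ)ˣ, (z : FiniteAdeleRing (𝓞 ℚ) ℚ) ∈ integralFiniteAdeles ℚ →
      ((diagGL2 z 1 : GL (Fin 2) (FiniteAdeleRing (𝓞 ℚ) ℚ)) : Matrix (Fin 2) (Fin 2) (FiniteAdeleRing (𝓞 ℚ) ℚ)) ∈
        eichlerOrder ℚ 𝔫 := by
    intro z hz
    obtain ⟨e00, e01, e10, e11⟩ := diagGL2_one_entries z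
    rw [mem_eichlerOrder_iff]
    refine ⟨fun i j => ?_, by rw [e10]; exact zero_mem _⟩
    fin_cases i <;> fin_cases j
    · simp only [Fin.zero_eta, Fin.isValue]; rw [e00]; exact hz
    · simp only [Fin.zero_eta, Fin.mk_one, Fin.isValue]; rw [e01]; exact zero_mem _
    · simp only [Fin.mk_one, Fin.zero_eta, Fin.isValue]; rw [e10]; exact zero_mem _
    · simp only [Fin.mk_one, Fin.isValue]; rw [e11]; exact one_mem _
  rw [mem_gammaOneFiniteLevel_iff, mem_gammaZeroFiniteLevel_iff, diagGL2_one_inv]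
  refine ⟨⟨hent y (Rat.mem_integralFiniteAdeles_of_mem_finiteIntegralUnits hy),
    hent y⁻¹ (Rat.mem_integralFiniteAdeles_of_mem_finiteIntegralUnits (inv_mem hy))⟩, ?_⟩
  rw [(diagGL2_one_entries y).2.2.2, sub_self]
  exact zero_mem _

/-- **`n(z) ∈ K₁(𝔫)` for `z ∈ ẑ`** (every level `𝔫`). [folklore] -/
theorem Rat.unipotentGL2_mem_gammaOneFiniteLevel {z : FiniteAdeleRing (𝓞 ℚ) ℚ}
    (hz : ∀ w : HeightOneSpectrum (𝓞 ℚ), z w ∈ w.adicCompletionIntegers ℚ) (𝔫 : Ideal (𝓞 ℚ)) :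
    ((unipotentGL2 z : ↥(upperUnitriangular (Fin 2) (FiniteAdeleRing (𝓞 ℚ) ℚ))) : GL (Fin 2) (FiniteAdeleRing (𝓞 ℚ) ℚ)) ∈
      gammaOneFiniteLevel ℚ 𝔫 := by
  have hent : ∀ x : FiniteAdeleRing (𝓞 ℚ) ℚ, (∀ w : HeightOneSpectrum (𝓞 ℚ), x w ∈ w.adicCompletionIntegers ℚ) →
      ((((unipotentGL2 x : ↥(upperUnitriangular (Fin 2) (FiniteAdeleRing (𝓞 ℚ) ℚ))) : GL (Fin 2) (FiniteAdeleRing (𝓞 ℚ) ℚ)) :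
        Matrix (Fin 2) (Fin 2) (FiniteAdeleRing (𝓞 ℚ) ℚ)) ∈ eichlerOrder ℚ 𝔫) := by
    intro x hx
    obtain ⟨e00, e01, e10, e11⟩ := unipotentGL2_entries x
    rw [mem_eichlerOrder_iff]
    refine ⟨fun i j => ?_, by rw [e10]; exact zero_mem _⟩
    fin_cases i <;> fin_cases j
    · simp only [Fin.zero_eta, Fin.isValue]; rw [e00]; exact one_mem _
    · simp only [Fin.zero_eta, Fin.mk_one, Fin.isValue]; rw [e01]; exact hx
    · simp only [Fin.mk_one, Fin.zero_eta, Fin.isValue]; rw [e10]; exact zero_mem _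
    · simp only [Fin.mk_one, Fin.isValue]; rw [e11]; exact one_mem _
  have hinv : (((unipotentGL2 z : ↥(upperUnitriangular (Fin 2) (FiniteAdeleRing (𝓞 ℚ) ℚ))) :
      GL (Fin 2) (FiniteAdeleRing (𝓞 ℚ) ℚ))⁻¹) =
      ((unipotentGL2 (-z) : ↥(upperUnitriangular (Fin 2) (FiniteAdeleRing (𝓞 ℚ) ℚ))) : GL (Fin 2) (FiniteAdeleRing (𝓞 ℚ) ℚ)) := by
    rw [unipotentGL2_neg_eq_inv, Subgroup.coe_inv]
  rw [mem_gammaOneFiniteLevel_iff, mem_gammaZeroFiniteLevel_iff, hinv]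
  refine ⟨⟨hent z hz, hent (-z) fun w => ?_⟩, ?_⟩
  · have e : (-z) w = -(z w) := rfl
    rw [e]
    exact neg_mem (hz w)
  · rw [(unipotentGL2_entries z).2.2.2, sub_self]
    exact zero_mem _

/-- `det (1, k) = 1` when `det k = 1`. [folklore] -/
theorem Rat.det_ofFinite_eq_one {k : GL (Fin 2) (FiniteAdeleRing (𝓞 ℚ) ℚ)} (hdet : Matrix.GeneralLinearGroup.det k = 1) :
    Matrix.GeneralLinearGroup.det (GLn.ofFinite 2 ℚ k) = 1 := by
  refine Units.ext (Prod.ext ?_ ?_)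
  · rw [Rat.det_ofFinite_fst]; rfl
  · rw [Rat.det_ofFinite_snd, hdet]; rfl

/-- **The ray class of `det (1, d(y))` is `y mod M`** for `y ∈ ẑˣ`. [folklore] -/
theorem Rat.rayClassHom_det_ofFinite_diagGL2 (M : ℕ) [NeZero M] {y : (FiniteAdeleRing (𝓞 ℚ) ℚ)ˣ}
    (hy : y ∈ Rat.finiteIntegralUnits) :
    Rat.rayClassHom M (Matrix.GeneralLinearGroup.det (GLn.ofFinite 2 ℚ (diagGL2 y 1))) = Rat.redMod M (Rat.finUnitHom y) := by
  have hint : diagGL2 y 1 ∈ glFiniteIntegralLevel 2 ℚ :=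
    gammaZeroFiniteLevel_le_glFiniteIntegralLevel _
      (gammaOneFiniteLevel_le_gammaZeroFiniteLevel _ (Rat.diagGL2_mem_gammaOneFiniteLevel hy ⊤))
  rw [Rat.rayClassHom_eq_redMod M _ (Rat.infReal_det_ofFinite_pos _) (Rat.valued_det_ofFinite_eq_one hint)]
  refine Rat.redMod_congr_primeFactors fun q => ?_
  rw [Rat.det_ofFinite_snd, det_diagGL2_one, Rat.finUnitHom_snd]

/-- `det k ∈ ẑˣ` for `k ∈ K₁(𝔫)`. [folklore] -/
theorem Rat.det_mem_finiteIntegralUnits {k : GL (Fin 2) (FiniteAdeleRing (𝓞 ℚ) ℚ)} (hk : k ∈ gammaOneFiniteLevel ℚ 𝔫) :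
    Matrix.GeneralLinearGroup.det k ∈ Rat.finiteIntegralUnits := fun w => by
  have h := Rat.valued_det_ofFinite_eq_one
    (gammaZeroFiniteLevel_le_glFiniteIntegralLevel _ (gammaOneFiniteLevel_le_gammaZeroFiniteLevel _ hk)) w
  rwa [Rat.det_ofFinite_snd] at h

end Elements

/-! ### Conjugating `K₁((dM)²)^{det = 1}` by `n(d⁻¹)` into `K₁(M²)` -/

section Conj

variable {M d : ℕ} [NeZero M] [NeZero d]

/-- The entries of `n(-c) u n(c)`: `(a - c γ, b + c (a - δ) - c² γ; γ, δ + c γ)` for `u = (a b; γ δ)`. [folklore] -/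
theorem conj_unipotentGL2_entries {R : Type*} [CommRing R] (c : R) (u : GL (Fin 2) R) :
    let k : GL (Fin 2) R := ((unipotentGL2 (-c) : ↥(upperUnitriangular (Fin 2) R)) : GL (Fin 2) R) * u *
      ((unipotentGL2 c : ↥(upperUnitriangular (Fin 2) R)) : GL (Fin 2) R)
    ((k : Matrix (Fin 2) (Fin 2) R) 0 0 = (u : Matrix (Fin 2) (Fin 2) R) 0 0 - c * (u : Matrix (Fin 2) (Fin 2) R) 1 0) ∧
    ((k : Matrix (Fin 2) (Fin 2) R) 0 1 = (u : Matrix (Fin 2) (Fin 2) R) 0 1 +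
        c * ((u : Matrix (Fin 2) (Fin 2) R) 0 0 - (u : Matrix (Fin 2) (Fin 2) R) 1 1) - c * c * (u : Matrix (Fin 2) (Fin 2) R) 1 0) ∧
    ((k : Matrix (Fin 2) (Fin 2) R) 1 0 = (u : Matrix (Fin 2) (Fin 2) R) 1 0) ∧
    ((k : Matrix (Fin 2) (Fin 2) R) 1 1 = (u : Matrix (Fin 2) (Fin 2) R) 1 1 + c * (u : Matrix (Fin 2) (Fin 2) R) 1 0) := by
  simp only [Units.val_mul, coe_unipotentGL2, Matrix.mul_apply, Fin.sum_univ_two]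
  simp
  refine ⟨by ring, by ring, by ring⟩

/-- **`n(-d⁻¹) u n(d⁻¹) ∈ K₁(M²)` for `u ∈ K₁((dM)²)` with `det u = 1`** (entries above: `γ ∈ (dM)² ẑ`,
`δ - 1 ∈ (dM)² ẑ` and `a - 1 ∈ dM ẑ` from `det u = 1`, so `d⁻¹ γ, d⁻² γ ∈ M² ẑ`, `d⁻¹ (a - δ) ∈ M ẑ`).
[folklore] -/
theorem Rat.conj_unipotentGL2_mem_gammaOneFiniteLevel {u : GL (Fin 2) (FiniteAdeleRing (𝓞 ℚ) ℚ)}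
    (hu : u ∈ gammaOneFiniteLevel ℚ (Ideal.span {(((d * M) ^ 2 : ℕ) : 𝓞 ℚ)}))
    (hdet : Matrix.GeneralLinearGroup.det u = 1) :
    ((unipotentGL2 (-(((Rat.natUnitFinite d)⁻¹ : (FiniteAdeleRing (𝓞 ℚ) ℚ)ˣ) : FiniteAdeleRing (𝓞 ℚ) ℚ)) :
        ↥(upperUnitriangular (Fin 2) (FiniteAdeleRing (𝓞 ℚ) ℚ))) : GL (Fin 2) (FiniteAdeleRing (𝓞 ℚ) ℚ)) * u *
      ((unipotentGL2 (((Rat.natUnitFinite d)⁻¹ : (FiniteAdeleRing (𝓞 ℚ) ℚ)ˣ) : FiniteAdeleRing (𝓞 ℚ) ℚ) :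
        ↥(upperUnitriangular (Fin 2) (FiniteAdeleRing (𝓞 ℚ) ℚ))) : GL (Fin 2) (FiniteAdeleRing (𝓞 ℚ) ℚ)) ∈
      gammaOneFiniteLevel ℚ (Ideal.span {((M ^ 2 : ℕ) : 𝓞 ℚ)}) := by
  set c : FiniteAdeleRing (𝓞 ℚ) ℚ := (((Rat.natUnitFinite d)⁻¹ : (FiniteAdeleRing (𝓞 ℚ) ℚ)ˣ) : FiniteAdeleRing (𝓞 ℚ) ℚ) with hc
  set nc : GL (Fin 2) (FiniteAdeleRing (𝓞 ℚ) ℚ) :=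
    ((unipotentGL2 c : ↥(upperUnitriangular (Fin 2) (FiniteAdeleRing (𝓞 ℚ) ℚ))) : GL (Fin 2) (FiniteAdeleRing (𝓞 ℚ) ℚ)) with hnc
  set nc' : GL (Fin 2) (FiniteAdeleRing (𝓞 ℚ) ℚ) :=
    ((unipotentGL2 (-c) : ↥(upperUnitriangular (Fin 2) (FiniteAdeleRing (𝓞 ℚ) ℚ))) : GL (Fin 2) (FiniteAdeleRing (𝓞 ℚ) ℚ)) with hnc'
  -- level bookkeeping: `(dM)² = d (d M²)`, `(dM)² ⊆ M²`, `(dM)² ⊆ dM = d M`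
  have eN2 : ((d * M) ^ 2 : ℕ) = d * (d * M ^ 2) := by ring
  have hle2 : levelIdeal ℚ (Ideal.span {(((d * M) ^ 2 : ℕ) : 𝓞 ℚ)}) ≤ levelIdeal ℚ (Ideal.span {((M ^ 2 : ℕ) : 𝓞 ℚ)}) :=
    Rat.levelIdeal_le_of_dvd (pow_ne_zero 2 (mul_ne_zero (NeZero.ne d) (NeZero.ne M))) ⟨d ^ 2, by ring⟩
  have hle1 : levelIdeal ℚ (Ideal.span {(((d * M) ^ 2 : ℕ) : 𝓞 ℚ)}) ≤ levelIdeal ℚ (Ideal.span {((d * M : ℕ) : 𝓞 ℚ)}) :=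
    Rat.levelIdeal_sq_le
  have hleM : levelIdeal ℚ (Ideal.span {((d * M ^ 2 : ℕ) : 𝓞 ℚ)}) ≤ levelIdeal ℚ (Ideal.span {((M ^ 2 : ℕ) : 𝓞 ℚ)}) :=
    Rat.levelIdeal_le_of_dvd (mul_ne_zero (NeZero.ne d) (pow_ne_zero 2 (NeZero.ne M))) (Dvd.intro_left d rfl)
  have hleM1 : levelIdeal ℚ (Ideal.span {(M : 𝓞 ℚ)}) ≤ levelIdeal ℚ (⊤ : Ideal (𝓞 ℚ)) := by
    intro x hx w
    exact (hx w).trans (idealRadius_le_one' w _) |>.trans (le_of_eq (by rw [idealRadius_top]))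
  -- `c x` for `x` in the various level ideals
  have hcN2 : ∀ x ∈ levelIdeal ℚ (Ideal.span {(((d * M) ^ 2 : ℕ) : 𝓞 ℚ)}),
      c * x ∈ levelIdeal ℚ (Ideal.span {((d * M ^ 2 : ℕ) : 𝓞 ℚ)}) := fun x hx => by
    rw [eN2] at hx
    exact Rat.natUnitFinite_inv_mul_mem_levelIdeal_of_mul hx
  have hccN2 : ∀ x ∈ levelIdeal ℚ (Ideal.span {(((d * M) ^ 2 : ℕ) : 𝓞 ℚ)}),
      c * c * x ∈ levelIdeal ℚ (Ideal.span {((M ^ 2 : ℕ) : 𝓞 ℚ)}) := fun x hx => by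
    rw [mul_assoc]
    exact Rat.natUnitFinite_inv_mul_mem_levelIdeal_of_mul (hcN2 x hx)
  have hcN : ∀ x ∈ levelIdeal ℚ (Ideal.span {((d * M : ℕ) : 𝓞 ℚ)}), c * x ∈ levelIdeal ℚ (Ideal.span {(M : 𝓞 ℚ)}) :=
    fun x hx => Rat.natUnitFinite_inv_mul_mem_levelIdeal_of_mul hx
  -- unpack `u ∈ K₁((dM)²)`, `det u = 1`
  have ha : (u : Matrix (Fin 2) (Fin 2) (FiniteAdeleRing (𝓞 ℚ) ℚ)) 0 0 - 1 ∈ levelIdeal ℚ (Ideal.span {((d * M : ℕ) : 𝓞 ℚ)}) :=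
    Rat.entry_sub_one_mem_levelIdeal_of_det hu (by rw [hdet, Units.val_one, sub_self]; exact zero_mem _)
  have hu' := hu
  rw [mem_gammaOneFiniteLevel_iff, mem_gammaZeroFiniteLevel_iff, mem_eichlerOrder_iff, mem_eichlerOrder_iff] at hu'
  obtain ⟨⟨⟨hint, hγ⟩, hint', hγ'⟩, hδ⟩ := hu'
  -- inverse of `u`: also `≡` conditions
  have hδ' : ((u⁻¹ : GL (Fin 2) (FiniteAdeleRing (𝓞 ℚ) ℚ)) : Matrix (Fin 2) (Fin 2) (FiniteAdeleRing (𝓞 ℚ) ℚ)) 1 1 - 1 ∈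
      levelIdeal ℚ (Ideal.span {(((d * M) ^ 2 : ℕ) : 𝓞 ℚ)}) := (inv_mem hu).2
  have ha' : ((u⁻¹ : GL (Fin 2) (FiniteAdeleRing (𝓞 ℚ) ℚ)) : Matrix (Fin 2) (Fin 2) (FiniteAdeleRing (𝓞 ℚ) ℚ)) 0 0 - 1 ∈
      levelIdeal ℚ (Ideal.span {((d * M : ℕ) : 𝓞 ℚ)}) :=
    Rat.entry_sub_one_mem_levelIdeal_of_det (inv_mem hu) (by rw [map_inv, hdet, inv_one, Units.val_one, sub_self]; exact zero_mem _)
  -- the Eichler-order part, uniformly for `u` and `u⁻¹`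
  have key : ∀ w : GL (Fin 2) (FiniteAdeleRing (𝓞 ℚ) ℚ),
      (∀ i j, (w : Matrix (Fin 2) (Fin 2) (FiniteAdeleRing (𝓞 ℚ) ℚ)) i j ∈ integralFiniteAdeles ℚ) →
      (w : Matrix (Fin 2) (Fin 2) (FiniteAdeleRing (𝓞 ℚ) ℚ)) 1 0 ∈ levelIdeal ℚ (Ideal.span {(((d * M) ^ 2 : ℕ) : 𝓞 ℚ)}) →
      (w : Matrix (Fin 2) (Fin 2) (FiniteAdeleRing (𝓞 ℚ) ℚ)) 1 1 - 1 ∈ levelIdeal ℚ (Ideal.span {(((d * M) ^ 2 : ℕ) : 𝓞 ℚ)}) →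
      (w : Matrix (Fin 2) (Fin 2) (FiniteAdeleRing (𝓞 ℚ) ℚ)) 0 0 - 1 ∈ levelIdeal ℚ (Ideal.span {((d * M : ℕ) : 𝓞 ℚ)}) →
      ((nc' * w * nc : GL (Fin 2) (FiniteAdeleRing (𝓞 ℚ) ℚ)) : Matrix (Fin 2) (Fin 2) (FiniteAdeleRing (𝓞 ℚ) ℚ)) ∈
          eichlerOrder ℚ (Ideal.span {((M ^ 2 : ℕ) : 𝓞 ℚ)}) ∧
        ((nc' * w * nc : GL (Fin 2) (FiniteAdeleRing (𝓞 ℚ) ℚ)) : Matrix (Fin 2) (Fin 2) (FiniteAdeleRing (𝓞 ℚ) ℚ)) 1 1 - 1 ∈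
          levelIdeal ℚ (Ideal.span {((M ^ 2 : ℕ) : 𝓞 ℚ)}) := by
    intro w hw h10 h11 h00
    obtain ⟨e00, e01, e10, e11⟩ := conj_unipotentGL2_entries c w
    have i10 : c * (w : Matrix (Fin 2) (Fin 2) (FiniteAdeleRing (𝓞 ℚ) ℚ)) 1 0 ∈ integralFiniteAdeles ℚ :=
      mem_integralFiniteAdeles_of_mem_levelIdeal (hcN2 _ h10)
    have idiff : c * ((w : Matrix (Fin 2) (Fin 2) (FiniteAdeleRing (𝓞 ℚ) ℚ)) 0 0 - (w : Matrix (Fin 2) (Fin 2) (FiniteAdeleRing (𝓞 ℚ) ℚ)) 1 1) ∈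
        integralFiniteAdeles ℚ := by
      have e : (w : Matrix (Fin 2) (Fin 2) (FiniteAdeleRing (𝓞 ℚ) ℚ)) 0 0 - (w : Matrix (Fin 2) (Fin 2) (FiniteAdeleRing (𝓞 ℚ) ℚ)) 1 1 =
          ((w : Matrix (Fin 2) (Fin 2) (FiniteAdeleRing (𝓞 ℚ) ℚ)) 0 0 - 1) - ((w : Matrix (Fin 2) (Fin 2) (FiniteAdeleRing (𝓞 ℚ) ℚ)) 1 1 - 1) := by
        ring
      rw [e]
      exact mem_integralFiniteAdeles_of_mem_levelIdeal (hcN _ (sub_mem h00 (hle1 h11)))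
    refine ⟨?_, ?_⟩
    · rw [mem_eichlerOrder_iff]
      refine ⟨fun i j => ?_, by rw [e10]; exact hle2 h10⟩
      fin_cases i <;> fin_cases j
      · simp only [Fin.zero_eta, Fin.isValue]; rw [e00]; exact sub_mem (hw 0 0) i10
      · simp only [Fin.zero_eta, Fin.mk_one, Fin.isValue]; rw [e01]
        exact sub_mem (add_mem (hw 0 1) idiff) (mem_integralFiniteAdeles_of_mem_levelIdeal (hccN2 _ h10))
      · simp only [Fin.mk_one, Fin.zero_eta, Fin.isValue]; rw [e10]; exact hw 1 0
      · simp only [Fin.mk_one, Fin.isValue]; rw [e11]; exact add_mem (hw 1 1) i10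
    · rw [e11]
      have e : (w : Matrix (Fin 2) (Fin 2) (FiniteAdeleRing (𝓞 ℚ) ℚ)) 1 1 + c * (w : Matrix (Fin 2) (Fin 2) (FiniteAdeleRing (𝓞 ℚ) ℚ)) 1 0 - 1 =
          ((w : Matrix (Fin 2) (Fin 2) (FiniteAdeleRing (𝓞 ℚ) ℚ)) 1 1 - 1) + c * (w : Matrix (Fin 2) (Fin 2) (FiniteAdeleRing (𝓞 ℚ) ℚ)) 1 0 := by
        ring
      rw [e]
      exact add_mem (hle2 h11) (hleM (hcN2 _ h10))
  have hinv : (nc' * u * nc)⁻¹ = nc' * u⁻¹ * nc := by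
    have e1 : nc⁻¹ = nc' := by rw [hnc, hnc', unipotentGL2_neg_eq_inv, Subgroup.coe_inv]
    have e2 : nc'⁻¹ = nc := by rw [← e1, inv_inv]
    rw [_root_.mul_inv_rev, _root_.mul_inv_rev, e1, e2, mul_assoc]
  obtain ⟨k1, k2⟩ := key u hint hγ hδ ha
  obtain ⟨k1', -⟩ := key u⁻¹ hint' hγ' hδ' ha'
  rw [mem_gammaOneFiniteLevel_iff, mem_gammaZeroFiniteLevel_iff, hinv]
  exact ⟨⟨k1, k1'⟩, k2⟩

end Conj

/-! ### The `χ([det] mod M)`-eigenvector of `K₁(M²)` -/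

section Eigenvector

variable {hcpt : isCompact_glFiniteIntegralLevel 2 ℚ} {M : ℕ} [NeZero M]

/-- **A `χ ∘ [det]`-eigenvector of `{1} × K₁(M²)` in `π`** (the vector underlying the tree's "new vector
up to twist", `AutomorphicRepData.exists_twist_mem_gammaOneFiniteInvariants`): from a non-zero
`K(M)`-fixed `ψ ∈ π`, a Dirichlet character `χ` mod `M` and a non-zero `v ∈ π` with
`r((1, k)) v = χ([det (1, k)] mod M) v` for all `k ∈ K₁(M²)` (an isotypic component of
`r(h_M) ψ`, `h_M = diag(M⁻¹, 1)`, under `K₁(M²)` acting through `[det] : K₁(M²) → (ℤ/M)ˣ`). [folklore] -/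
theorem AutomorphicRepData.exists_detChar_eigenvector (π : AutomorphicRepData (AutomorphyDatum.gl 2 ℚ hcpt))
    {ψ : (AdelicGroupData.gl 2 ℚ).Adelic → ℂ} (hψW : ψ ∈ π.W) (hψ0 : ψ ≠ 0)
    (hfix : ∀ u ∈ principalCongruenceLevel 2 ℚ (Ideal.span {(M : 𝓞 ℚ)}), rightTranslation (AdelicGroupData.gl 2 ℚ) u ψ = ψ) :
    ∃ (χ : DirichletCharacter ℂ M), ∃ v ∈ π.W, v ≠ 0 ∧
      ∀ k ∈ gammaOneFiniteLevel ℚ (Ideal.span {((M ^ 2 : ℕ) : 𝓞 ℚ)}),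
        rightTranslation (AdelicGroupData.gl 2 ℚ) (GLn.ofFinite 2 ℚ k) v =
          χ ((Rat.rayClassHom M (Matrix.GeneralLinearGroup.det (GLn.ofFinite 2 ℚ k)) : (ZMod M)ˣ) : ZMod M) • v := by
  set h := GLn.ofFinite 2 ℚ (Rat.levelRaisingElt M) with hh
  set ψ₁ := rightTranslation (AdelicGroupData.gl 2 ℚ) h ψ with hψ₁
  have hstab : ∀ (x : GL (Fin 2) (FiniteAdeleRing (𝓞 ℚ) ℚ)) (w : (AdelicGroupData.gl 2 ℚ).Adelic → ℂ), w ∈ π.W →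
      rightTranslation (AdelicGroupData.gl 2 ℚ) (GLn.ofFinite 2 ℚ x) w ∈ π.W :=
    fun x w hw => π.stable.finite_stable (GLn.ofFinite 2 ℚ x) ⟨x, rfl⟩ hw
  have hψ₁W : ψ₁ ∈ π.W := hstab _ _ hψW
  have hψ₁0 : ψ₁ ≠ 0 := by
    intro h0
    apply hψ0
    have e : rightTranslation (AdelicGroupData.gl 2 ℚ) h⁻¹ ψ₁ = ψ := by
      rw [hψ₁, ← Module.End.mul_apply, ← map_mul, inv_mul_cancel, map_one, Module.End.one_apply]
    rw [← e, h0, map_zero]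
  have hker : ∀ k : gammaOneFiniteLevel ℚ (Ideal.span {((M ^ 2 : ℕ) : 𝓞 ℚ)}), detRayClass M (M ^ 2) k = 1 →
      gammaOneRep (M ^ 2) k ψ₁ = ψ₁ := fun k hk => gammaOneRep_rightTranslation_levelRaisingElt hfix k hk
  obtain ⟨χ, hχ⟩ := exists_charComponent_ne_zero (gammaOneRep (M ^ 2)) (detRayClass M (M ^ 2)) hker hψ₁0
  refine ⟨χ, charComponent (gammaOneRep (M ^ 2)) (detRayClass M (M ^ 2)) χ ψ₁,
    charComponent_mem _ _ (fun k w hw => hstab _ _ hw) χ hψ₁W, hχ, fun k hk => ?_⟩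
  have heq := apply_charComponent (gammaOneRep (M ^ 2)) (detRayClass M (M ^ 2)) χ hker ⟨k, hk⟩
  rw [gammaOneRep_apply, detRayClass_apply] at heq
  exact heq

end Eigenvector

/-! ### The torus action of `ẑˣ` and the Gauss-sum torus average -/

section Operator

/-- `r(g) (r(h) φ) = r(g h) φ` (spelt with the product in `GL₂(𝔸_ℚ)`). [folklore] -/
theorem rightTranslation_rightTranslation (g h : GL (Fin 2) (AdeleRing (𝓞 ℚ) ℚ)) (φ : (AdelicGroupData.gl 2 ℚ).Adelic → ℂ) :
    rightTranslation (AdelicGroupData.gl 2 ℚ) g (rightTranslation (AdelicGroupData.gl 2 ℚ) h φ) =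
      rightTranslation (AdelicGroupData.gl 2 ℚ) (g * h) φ := by
  rw [← Module.End.mul_apply, ← map_mul]
  rfl

/-- The **torus action** `ρ(y) = r((1, d(y)))` of `ẑˣ` on functions on `GL₂(𝔸_ℚ)`. [folklore] -/
def Rat.finTorusRep : Representation ℂ ↥Rat.finiteIntegralUnits ((AdelicGroupData.gl 2 ℚ).Adelic → ℂ) :=
  (rightTranslation (AdelicGroupData.gl 2 ℚ)).comp
    ((GLn.ofFinite 2 ℚ).comp ((diagOneHom (FiniteAdeleRing (𝓞 ℚ) ℚ)).comp (Subgroup.subtype _)))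

/-- Unfolding `Rat.finTorusRep`. [folklore] -/
theorem Rat.finTorusRep_apply (y : ↥Rat.finiteIntegralUnits) (φ : (AdelicGroupData.gl 2 ℚ).Adelic → ℂ) :
    Rat.finTorusRep y φ =
      rightTranslation (AdelicGroupData.gl 2 ℚ) (GLn.ofFinite 2 ℚ (diagGL2 (y : (FiniteAdeleRing (𝓞 ℚ) ℚ)ˣ) 1)) φ := rfl

/-- The reduction `ẑˣ → (ℤ/N)ˣ` (`Rat.redMod N` on `(1, y)`). [folklore] -/
def Rat.finTorusRed (N : ℕ) [NeZero N] : ↥Rat.finiteIntegralUnits →* (ZMod N)ˣ :=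
  (Rat.redMod N).comp (Rat.finUnitHom.comp (Subgroup.subtype _))

/-- Unfolding `Rat.finTorusRed`. [folklore] -/
theorem Rat.finTorusRed_apply (N : ℕ) [NeZero N] (y : ↥Rat.finiteIntegralUnits) :
    Rat.finTorusRed N y = Rat.redMod N (Rat.finUnitHom (y : (FiniteAdeleRing (𝓞 ℚ) ℚ)ˣ)) := rfl

/-- **`ẑˣ → (ℤ/N)ˣ` is onto** (`Rat.exists_redMod_finUnitHom_eq`). [cite: NeukirchANT1999, Ch. VI Prop. (1.10)] -/
theorem Rat.finTorusRed_range (N : ℕ) [NeZero N] : (Rat.finTorusRed N).range = ⊤ := by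
  rw [eq_top_iff]
  intro a _
  obtain ⟨y, hy, h⟩ := Rat.exists_redMod_finUnitHom_eq (N := N) a
  exact ⟨⟨y, hy⟩, by rw [Rat.finTorusRed_apply]; exact h⟩

/-- Every class is in the range of `Rat.finTorusRed N`. [folklore] -/
theorem Rat.mem_range_finTorusRed (N : ℕ) [NeZero N] (a : (ZMod N)ˣ) : a ∈ (Rat.finTorusRed N).range := by
  rw [Rat.finTorusRed_range]; exact Subgroup.mem_top a

variable (M d : ℕ) [NeZero M] [NeZero d]

/-- The finite-adelic unipotent `n(d⁻¹) ∈ GL₂(𝔸_ℚ)` (`d⁻¹ ∈ ℚˣ ⊆ (𝔸_ℚ^∞)ˣ`). [folklore] -/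
def Rat.invUnipotent : GL (Fin 2) (AdeleRing (𝓞 ℚ) ℚ) :=
  GLn.ofFinite 2 ℚ ((unipotentGL2 (((Rat.natUnitFinite d)⁻¹ : (FiniteAdeleRing (𝓞 ℚ) ℚ)ˣ) : FiniteAdeleRing (𝓞 ℚ) ℚ) :
    ↥(upperUnitriangular (Fin 2) (FiniteAdeleRing (𝓞 ℚ) ℚ))) : GL (Fin 2) (FiniteAdeleRing (𝓞 ℚ) ℚ))

/-- **The Gauss-sum torus average** `B_d v = ∑_{a ∈ (ℤ/dM)ˣ} r((1, d(s_a) n(d⁻¹))) v`: the isotypic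
component for the trivial character of `r((1, n(d⁻¹))) v` under the torus `d(ẑˣ)` acting through
`ẑˣ → (ℤ/dM)ˣ` (`charComponent`; `s_a ∈ ẑˣ` its section `rangeSection`). [folklore] -/
def gaussTorusAverage (v : (AdelicGroupData.gl 2 ℚ).Adelic → ℂ) : (AdelicGroupData.gl 2 ℚ).Adelic → ℂ :=
  charComponent Rat.finTorusRep (Rat.finTorusRed (d * M)) 1 (rightTranslation (AdelicGroupData.gl 2 ℚ) (Rat.invUnipotent d) v)

variable {M d}

variable {hcpt : isCompact_glFiniteIntegralLevel 2 ℚ}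

/-- `B_d v ∈ π` for `v ∈ π` (finite right translates stay in `π`). [folklore] -/
theorem gaussTorusAverage_mem (π : AutomorphicRepData (AutomorphyDatum.gl 2 ℚ hcpt))
    {v : (AdelicGroupData.gl 2 ℚ).Adelic → ℂ} (hv : v ∈ π.W) : gaussTorusAverage M d v ∈ π.W := by
  have hstab : ∀ (x : GL (Fin 2) (FiniteAdeleRing (𝓞 ℚ) ℚ)) (w : (AdelicGroupData.gl 2 ℚ).Adelic → ℂ), w ∈ π.W →
      rightTranslation (AdelicGroupData.gl 2 ℚ) (GLn.ofFinite 2 ℚ x) w ∈ π.W :=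
    fun x w hw => π.stable.finite_stable (GLn.ofFinite 2 ℚ x) ⟨x, rfl⟩ hw
  exact charComponent_mem _ _ (fun y w hw => hstab _ _ hw) 1 (hstab _ _ hv)

-- the eigenvector hypothesis `hv`: `r((1, k)) v = χ([det (1, k)] mod M) v` on `K₁(M²)`
variable (χ : DirichletCharacter ℂ M) {v : (AdelicGroupData.gl 2 ℚ).Adelic → ℂ}
  (hv : ∀ k ∈ gammaOneFiniteLevel ℚ (Ideal.span {((M ^ 2 : ℕ) : 𝓞 ℚ)}),
    rightTranslation (AdelicGroupData.gl 2 ℚ) (GLn.ofFinite 2 ℚ k) v =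
      χ ((Rat.rayClassHom M (Matrix.GeneralLinearGroup.det (GLn.ofFinite 2 ℚ k)) : (ZMod M)ˣ) : ZMod M) • v)

include hv

omit [NeZero d] in
/-- An eigenvector is fixed by the `k ∈ K₁(M²)` with `det k = 1`. [folklore] -/
theorem rightTranslation_eq_of_det_eq_one {k : GL (Fin 2) (FiniteAdeleRing (𝓞 ℚ) ℚ)}
    (hk : k ∈ gammaOneFiniteLevel ℚ (Ideal.span {((M ^ 2 : ℕ) : 𝓞 ℚ)})) (hdet : Matrix.GeneralLinearGroup.det k = 1) :
    rightTranslation (AdelicGroupData.gl 2 ℚ) (GLn.ofFinite 2 ℚ k) v = v := by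
  rw [hv k hk, Rat.det_ofFinite_eq_one hdet, map_one, Units.val_one, map_one, one_smul]

omit [NeZero d] in
/-- An eigenvector is fixed by `n(z)`, `z ∈ ẑ`. [folklore] -/
theorem rightTranslation_unipotentGL2_eq {z : FiniteAdeleRing (𝓞 ℚ) ℚ}
    (hz : ∀ w : HeightOneSpectrum (𝓞 ℚ), z w ∈ w.adicCompletionIntegers ℚ) :
    rightTranslation (AdelicGroupData.gl 2 ℚ) (GLn.ofFinite 2 ℚ ((unipotentGL2 z :
      ↥(upperUnitriangular (Fin 2) (FiniteAdeleRing (𝓞 ℚ) ℚ))) : GL (Fin 2) (FiniteAdeleRing (𝓞 ℚ) ℚ))) v = v :=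
  rightTranslation_eq_of_det_eq_one χ hv (Rat.unipotentGL2_mem_gammaOneFiniteLevel hz _) (det_coe_unipotentGL2 z)

omit [NeZero d] in
/-- An eigenvector transforms under `d(y)`, `y ∈ ẑˣ`, by `χ(y mod M)`. [folklore] -/
theorem rightTranslation_diagGL2_eq {y : (FiniteAdeleRing (𝓞 ℚ) ℚ)ˣ} (hy : y ∈ Rat.finiteIntegralUnits) :
    rightTranslation (AdelicGroupData.gl 2 ℚ) (GLn.ofFinite 2 ℚ (diagGL2 y 1)) v =
      χ ((Rat.redMod M (Rat.finUnitHom y) : (ZMod M)ˣ) : ZMod M) • v := by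
  rw [hv _ (Rat.diagGL2_mem_gammaOneFiniteLevel hy _), Rat.rayClassHom_det_ofFinite_diagGL2 M hy]

/-- **The kernel of `ẑˣ → (ℤ/dM)ˣ` fixes `x₀ = r((1, n(d⁻¹))) v`**: for `s ≡ 1 (dM)`,
`d(s) n(d⁻¹) = n(d⁻¹) n((s - 1) d⁻¹) d(s)` with `(s - 1) d⁻¹ ∈ M ẑ ⊆ ẑ` and `χ(s mod M) = 1`. [folklore] -/
theorem finTorusRep_unipotentTranslate_eq (g : ↥Rat.finiteIntegralUnits)
    (hg : Rat.finTorusRed (d * M) g = 1) :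
    Rat.finTorusRep g (rightTranslation (AdelicGroupData.gl 2 ℚ) (Rat.invUnipotent d) v) =
      rightTranslation (AdelicGroupData.gl 2 ℚ) (Rat.invUnipotent d) v := by
  set c : FiniteAdeleRing (𝓞 ℚ) ℚ := (((Rat.natUnitFinite d)⁻¹ : (FiniteAdeleRing (𝓞 ℚ) ℚ)ˣ) : FiniteAdeleRing (𝓞 ℚ) ℚ) with hc
  have hgu : (g : (FiniteAdeleRing (𝓞 ℚ) ℚ)ˣ) ∈ Rat.finiteIntegralUnits := g.2
  -- `s - 1 ∈ dM ẑ`, so `(s - 1) c ∈ M ẑ ⊆ ẑ`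
  have hs1 : ((g : (FiniteAdeleRing (𝓞 ℚ) ℚ)ˣ) : FiniteAdeleRing (𝓞 ℚ) ℚ) - 1 ∈ levelIdeal ℚ (Ideal.span {((d * M : ℕ) : 𝓞 ℚ)}) := by
    have h := Rat.sub_one_mem_levelIdeal_of_redMod_eq_one (Rat.valued_finUnitHom_snd hgu) hg
    rwa [Rat.finUnitHom_snd] at h
  have hz : ∀ w : HeightOneSpectrum (𝓞 ℚ), (c * (((g : (FiniteAdeleRing (𝓞 ℚ) ℚ)ˣ) : FiniteAdeleRing (𝓞 ℚ) ℚ) - 1)) w ∈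
      w.adicCompletionIntegers ℚ := fun w =>
    mem_integralFiniteAdeles_of_mem_levelIdeal (Rat.natUnitFinite_inv_mul_mem_levelIdeal_of_mul hs1) w
  -- `χ(s mod M) = 1`
  have hM : Rat.redMod M (Rat.finUnitHom (g : (FiniteAdeleRing (𝓞 ℚ) ℚ)ˣ)) = 1 := by
    rw [← Rat.unitsMap_redMod (Dvd.intro_left d rfl) hgu, ← Rat.finTorusRed_apply, hg, map_one]
  -- `d(s) n(c) = n(c) (n(c (s - 1)) d(s))`
  have e0 : diagGL2 (g : (FiniteAdeleRing (𝓞 ℚ) ℚ)ˣ) 1 *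
      ((unipotentGL2 c : ↥(upperUnitriangular (Fin 2) (FiniteAdeleRing (𝓞 ℚ) ℚ))) : GL (Fin 2) (FiniteAdeleRing (𝓞 ℚ) ℚ)) =
      ((unipotentGL2 c : ↥(upperUnitriangular (Fin 2) (FiniteAdeleRing (𝓞 ℚ) ℚ))) : GL (Fin 2) (FiniteAdeleRing (𝓞 ℚ) ℚ)) *
        (((unipotentGL2 (c * (((g : (FiniteAdeleRing (𝓞 ℚ) ℚ)ˣ) : FiniteAdeleRing (𝓞 ℚ) ℚ) - 1)) :
          ↥(upperUnitriangular (Fin 2) (FiniteAdeleRing (𝓞 ℚ) ℚ))) : GL (Fin 2) (FiniteAdeleRing (𝓞 ℚ) ℚ)) *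
          diagGL2 (g : (FiniteAdeleRing (𝓞 ℚ) ℚ)ˣ) 1) := by
    rw [diagGL2_mul_unipotentGL2, ← mul_assoc, ← Subgroup.coe_mul, ← unipotentGL2_add]
    congr 3
    ring
  have e : GLn.ofFinite 2 ℚ (diagGL2 (g : (FiniteAdeleRing (𝓞 ℚ) ℚ)ˣ) 1) * Rat.invUnipotent d =
      Rat.invUnipotent d * (GLn.ofFinite 2 ℚ ((unipotentGL2 (c * (((g : (FiniteAdeleRing (𝓞 ℚ) ℚ)ˣ) : FiniteAdeleRing (𝓞 ℚ) ℚ) - 1)) :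
        ↥(upperUnitriangular (Fin 2) (FiniteAdeleRing (𝓞 ℚ) ℚ))) : GL (Fin 2) (FiniteAdeleRing (𝓞 ℚ) ℚ)) *
        GLn.ofFinite 2 ℚ (diagGL2 (g : (FiniteAdeleRing (𝓞 ℚ) ℚ)ˣ) 1)) := by
    rw [Rat.invUnipotent, ← hc, ← map_mul, e0, map_mul, map_mul]
  rw [Rat.finTorusRep_apply, rightTranslation_rightTranslation, e, ← rightTranslation_rightTranslation,
    ← rightTranslation_rightTranslation, rightTranslation_diagGL2_eq χ hv hgu, hM, Units.val_one, map_one, one_smul,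
    rightTranslation_unipotentGL2_eq χ hv hz]

/-- **`B_d v` is fixed by the torus `d(ẑˣ)`** (equivariance of the isotypic component for the trivial
character). [folklore] -/
theorem rightTranslation_diagGL2_gaussTorusAverage {y : (FiniteAdeleRing (𝓞 ℚ) ℚ)ˣ}
    (hy : y ∈ Rat.finiteIntegralUnits) :
    rightTranslation (AdelicGroupData.gl 2 ℚ) (GLn.ofFinite 2 ℚ (diagGL2 y 1)) (gaussTorusAverage M d v) =
      gaussTorusAverage M d v := by
  have h := apply_charComponent Rat.finTorusRep (Rat.finTorusRed (d * M)) 1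
    (finTorusRep_unipotentTranslate_eq (d := d) χ hv) ⟨y, hy⟩
  rw [MulChar.one_apply_coe, one_smul] at h
  exact h

omit [NeZero M] [NeZero d] hv in
/-- A linear operator commuting with the torus up to operators fixing `x₀` fixes every isotypic
component of `x₀`. [folklore] -/
theorem charComponent_eq_of_forall_intertwine {G : Type*} [Group G] {V : Type*} [AddCommGroup V] [Module ℂ V]
    (ρ : Representation ℂ G V) {m : ℕ} [NeZero m] (r : G →* (ZMod m)ˣ) (χ₁ : DirichletCharacter ℂ m) {x : V}
    {P : Module.End ℂ V} (h : ∀ g : G, ∃ Q : Module.End ℂ V, P * ρ g = ρ g * Q ∧ Q x = x) :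
    P (charComponent ρ r χ₁ x) = charComponent ρ r χ₁ x := by
  unfold charComponent
  rw [map_sum]
  refine Finset.sum_congr rfl fun a _ => ?_
  split_ifs
  · obtain ⟨Q, hPQ, hQ⟩ := h (rangeSection r a)
    rw [map_smul, ← Module.End.mul_apply, hPQ, Module.End.mul_apply, hQ]
  · rw [map_zero]

/-- **`B_d v` is fixed by `{k ∈ K₁((dM)²) | det k = 1}`**: `(1, k) (1, d(s)) = (1, d(s)) (1, kˢ)` with
`kˢ = d(s)⁻¹ k d(s)` again in this group, and `kˢ n(d⁻¹) = n(d⁻¹) (n(-d⁻¹) kˢ n(d⁻¹))` with the last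
factor in `K₁(M²)` of determinant `1` (`Rat.conj_unipotentGL2_mem_gammaOneFiniteLevel`). [folklore] -/
theorem rightTranslation_gaussTorusAverage_of_det_eq_one {k : GL (Fin 2) (FiniteAdeleRing (𝓞 ℚ) ℚ)}
    (hk : k ∈ gammaOneFiniteLevel ℚ (Ideal.span {(((d * M) ^ 2 : ℕ) : 𝓞 ℚ)})) (hdet : Matrix.GeneralLinearGroup.det k = 1) :
    rightTranslation (AdelicGroupData.gl 2 ℚ) (GLn.ofFinite 2 ℚ k) (gaussTorusAverage M d v) = gaussTorusAverage M d v := by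
  -- the conjugation step, for any `u` in the group
  have hfixU : ∀ u ∈ gammaOneFiniteLevel ℚ (Ideal.span {(((d * M) ^ 2 : ℕ) : 𝓞 ℚ)}), Matrix.GeneralLinearGroup.det u = 1 →
      rightTranslation (AdelicGroupData.gl 2 ℚ) (GLn.ofFinite 2 ℚ u) (rightTranslation (AdelicGroupData.gl 2 ℚ) (Rat.invUnipotent d) v) =
        rightTranslation (AdelicGroupData.gl 2 ℚ) (Rat.invUnipotent d) v := by
    intro u hu hdu
    set c : FiniteAdeleRing (𝓞 ℚ) ℚ := (((Rat.natUnitFinite d)⁻¹ : (FiniteAdeleRing (𝓞 ℚ) ℚ)ˣ) : FiniteAdeleRing (𝓞 ℚ) ℚ) with hc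
    set nc : GL (Fin 2) (FiniteAdeleRing (𝓞 ℚ) ℚ) :=
      ((unipotentGL2 c : ↥(upperUnitriangular (Fin 2) (FiniteAdeleRing (𝓞 ℚ) ℚ))) : GL (Fin 2) (FiniteAdeleRing (𝓞 ℚ) ℚ)) with hnc
    set k' : GL (Fin 2) (FiniteAdeleRing (𝓞 ℚ) ℚ) :=
      ((unipotentGL2 (-c) : ↥(upperUnitriangular (Fin 2) (FiniteAdeleRing (𝓞 ℚ) ℚ))) : GL (Fin 2) (FiniteAdeleRing (𝓞 ℚ) ℚ)) * u * nc
      with hk'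
    have hk'mem : k' ∈ gammaOneFiniteLevel ℚ (Ideal.span {((M ^ 2 : ℕ) : 𝓞 ℚ)}) :=
      Rat.conj_unipotentGL2_mem_gammaOneFiniteLevel hu hdu
    have hk'det : Matrix.GeneralLinearGroup.det k' = 1 := by
      rw [hk', map_mul, map_mul, hdu, det_coe_unipotentGL2, det_coe_unipotentGL2, mul_one, mul_one]
    have e : u * nc = nc * k' := by
      rw [hk', ← mul_assoc, ← mul_assoc, hnc, ← Subgroup.coe_mul, ← unipotentGL2_add, add_neg_cancel, unipotentGL2_zero,
        Subgroup.coe_one, one_mul]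
    have e' : GLn.ofFinite 2 ℚ u * Rat.invUnipotent d = Rat.invUnipotent d * GLn.ofFinite 2 ℚ k' := by
      rw [Rat.invUnipotent, ← hc, ← hnc, ← map_mul, e, map_mul]
    rw [rightTranslation_rightTranslation, e', ← rightTranslation_rightTranslation, rightTranslation_eq_of_det_eq_one χ hv hk'mem hk'det]
  refine charComponent_eq_of_forall_intertwine Rat.finTorusRep (Rat.finTorusRed (d * M)) 1 fun g => ?_
  have hgu : (g : (FiniteAdeleRing (𝓞 ℚ) ℚ)ˣ) ∈ Rat.finiteIntegralUnits := g.2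
  set t : GL (Fin 2) (FiniteAdeleRing (𝓞 ℚ) ℚ) := diagGL2 (g : (FiniteAdeleRing (𝓞 ℚ) ℚ)ˣ) 1 with ht
  have htmem : t ∈ gammaOneFiniteLevel ℚ (Ideal.span {(((d * M) ^ 2 : ℕ) : 𝓞 ℚ)}) := Rat.diagGL2_mem_gammaOneFiniteLevel hgu _
  set u : GL (Fin 2) (FiniteAdeleRing (𝓞 ℚ) ℚ) := t⁻¹ * k * t with hu
  have humem : u ∈ gammaOneFiniteLevel ℚ (Ideal.span {(((d * M) ^ 2 : ℕ) : 𝓞 ℚ)}) := mul_mem (mul_mem (inv_mem htmem) hk) htmem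
  have hudet : Matrix.GeneralLinearGroup.det u = 1 := by
    rw [hu, map_mul, map_mul, map_inv, hdet, mul_one, inv_mul_cancel]
  refine ⟨rightTranslation (AdelicGroupData.gl 2 ℚ) (GLn.ofFinite 2 ℚ u), ?_, hfixU u humem hudet⟩
  have e2 : GLn.ofFinite 2 ℚ k * GLn.ofFinite 2 ℚ t = GLn.ofFinite 2 ℚ t * GLn.ofFinite 2 ℚ u := by
    rw [← map_mul, ← map_mul, hu, ← mul_assoc, ← mul_assoc, mul_inv_cancel, one_mul]
  change rightTranslation (AdelicGroupData.gl 2 ℚ) (GLn.ofFinite 2 ℚ k) * rightTranslation (AdelicGroupData.gl 2 ℚ) (GLn.ofFinite 2 ℚ t) =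
    rightTranslation (AdelicGroupData.gl 2 ℚ) (GLn.ofFinite 2 ℚ t) * rightTranslation (AdelicGroupData.gl 2 ℚ) (GLn.ofFinite 2 ℚ u)
  rw [← map_mul, ← map_mul]
  exact congrArg _ e2

/-- **`B_d v` is right invariant under `{1} × K₁((dM)²)`**: `K₁ = d(ẑˣ) · K₁^{det = 1}`
(`k = d(det k) · (d(det k)⁻¹ k)`, `det k ∈ ẑˣ`). [folklore] -/
theorem gaussTorusAverage_mem_gammaOneFiniteInvariants :
    gaussTorusAverage M d v ∈ gammaOneFiniteInvariants ((d * M) ^ 2) := by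
  rw [mem_gammaOneFiniteInvariants_iff_rightTranslation]
  intro k hk
  set y : (FiniteAdeleRing (𝓞 ℚ) ℚ)ˣ := Matrix.GeneralLinearGroup.det k with hy
  have hyu : y ∈ Rat.finiteIntegralUnits := Rat.det_mem_finiteIntegralUnits hk
  set u : GL (Fin 2) (FiniteAdeleRing (𝓞 ℚ) ℚ) := (diagGL2 y 1)⁻¹ * k with hu
  have humem : u ∈ gammaOneFiniteLevel ℚ (Ideal.span {(((d * M) ^ 2 : ℕ) : 𝓞 ℚ)}) :=
    mul_mem (inv_mem (Rat.diagGL2_mem_gammaOneFiniteLevel hyu _)) hk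
  have hudet : Matrix.GeneralLinearGroup.det u = 1 := by
    rw [hu, map_mul, map_inv, det_diagGL2_one, hy, inv_mul_cancel]
  have e : k = diagGL2 y 1 * u := by rw [hu, mul_inv_cancel_left]
  rw [e, map_mul, ← rightTranslation_rightTranslation, rightTranslation_gaussTorusAverage_of_det_eq_one χ hv humem hudet,
    rightTranslation_diagGL2_gaussTorusAverage χ hv hyu]

omit hv in
/-- **Pointwise formula**: `B_d v (x) = ∑_{a ∈ (ℤ/dM)ˣ} v(x · (1, d(s_a) n(d⁻¹)))` with `s = rangeSection`
(the reduction `ẑˣ → (ℤ/dM)ˣ` is onto and the character is trivial). [folklore] -/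
theorem gaussTorusAverage_apply (v : (AdelicGroupData.gl 2 ℚ).Adelic → ℂ) (x : GL (Fin 2) (AdeleRing (𝓞 ℚ) ℚ)) :
    gaussTorusAverage M d v x = ∑ a : (ZMod (d * M))ˣ,
      v (x * (GLn.ofFinite 2 ℚ (diagGL2 ((rangeSection (Rat.finTorusRed (d * M)) a : ↥Rat.finiteIntegralUnits) :
        (FiniteAdeleRing (𝓞 ℚ) ℚ)ˣ) 1) * Rat.invUnipotent d)) := by
  unfold gaussTorusAverage charComponent
  rw [Finset.sum_apply]
  refine Finset.sum_congr rfl fun a _ => ?_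
  rw [if_pos (Rat.mem_range_finTorusRed _ a), MulChar.one_apply_coe, one_smul, Rat.finTorusRep_apply,
    rightTranslation_apply, rightTranslation_apply]
  exact congrArg v (mul_assoc _ _ _)

end Operator

end Literature.NumberTheory.Automorphic

end
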